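import Summits.QuantumFields.YangMills.Theorems.LuscherReductionTwistedTraceScalingBOStiffSepLink
import Summits.QuantumFields.YangMills.Theorems.LuscherReductionTwistedTraceScalingBOStiffSepProj
import Summits.QuantumFields.YangMills.Theorems.LuscherReductionTwistedTraceScalingBOCoreComplement
import Summits.QuantumFields.YangMills.Theorems.LuscherReductionTwistedTraceScalingBTTubeMagnetic
import Summits.QuantumFields.YangMills.Theorems.FlatTubeReductionCoreAmplitudes
import Summits.QuantumFields.YangMills.Theorems.TwistedTraceScaling.Negative.CentralGlueCoSupport
import HarnessLib

/-!
# (C5-α, S6′) STIFF SEPARATION FOR A BASED NEAR-IDENTITY GAUGE FIELD: the two-round bootstrap `ϑ → g₁ → radius`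
# (lane A of S-BASE, crux `TwistedTraceScaling` stmt-QuantumFields-20203, C4-CORE, the (OD) pen; §4 of `pub/ym-fleet/ym-luscher-20007-p1/Lines-stiff-separation.md`)

Tube points `U' = oT u' x'`, `V = oT u x` (`x, x'` cap-balanced, `‖x_e‖∞ ≤ ω`, `|u⃗_k|∞ ≤ τ_u`, `‖P_Γ x̂'‖, ‖P_Γ x̂‖ ≤ τ`) and a BASED gauge parameter `ζ` (`ζ 0 = 0`) with
`kinDefect U' V (chartSU2∘ζ) ≤ d²`.  One ROUND (`stiffSep_round`): from ANY a-priori bound `‖ζ_y‖∞ ≤ G ≤ 1/40`, `‖ζ̄‖∞ ≤ G_m`, the link-space identity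
(`…BOStiffSepLink.stiffSep_linkSpace_bound`, error `Y(G,G_m) = √6·d + √(6|E|)(40(4G² + 2Gω) + 12τ_uG_m + 4(6G + 2ω)m)`) and the projection step (`…BOStiffSepProj.stiffSep_radius_bound`)
give `‖ζ − ζ̄‖∞ ≤ 2C_P(2τ + Y(G,G_m))` and `‖x̂'‖² ≤ τ² + (‖x̂‖ + 4τ + 4Y(G,G_m))²`.  Since `ζ` is based, `‖ζ̄‖ ≤ ‖ζ − ζ̄‖∞` and `‖ζ_y‖ ≤ 2‖ζ − ζ̄‖∞`: the output of a round is a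
new input.  ★★★ `stiffSep_based`: two rounds, `(G, G_m) = (ϑ, ϑ) ↦ (2g₁, g₁)`, `g₁ = 2C_P(2τ + Y(ϑ,ϑ))`, conclude `‖x̂'‖² ≤ τ² + (‖x̂‖ + 4τ + 4Y(2g₁, g₁))²`.
On schedule B (`ϑ = O(LMβ^{-s})`, `τ = β^{-1}ℓ`, `ω ≤ r_f/24`, `τ_u = O(β^{-s})`, `m = O(β^{-s})`, `d = r_f/C`): `g₁ = O(β^{-2s})`, `Y(2g₁,g₁) = √6·d + O(β^{-4s} + β^{-2s}r_f + β^{-3s})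
= √6·d + o(r_f)` iff `s > 1/6` — so `‖x̂'‖ < r_f/12` once `‖x̂‖ ≤ r_f/24` and `d ≪ r_f`: the contrapositive is (SEP).  Also `norm_covRel_sub_one_le` (`‖q(covRel_e) − 1‖ ≤ 6G + 2ω`; `R45.norm_su2Quat_inv_sub_one` reused).
HONEST FRAMING: algebra for a stub of a child of the CONDITIONAL route R2b1; the colour reduction (S2 wrapper), the eventual schedule of (SEP), the hOD assembly, (B-ST), C4-CORE
OPEN; not infinite volume, not a gap, not Clay.
-/

set_option autoImplicit false

noncomputable section

open Real
open scoped BigOperators Matrix Quaternion RealInnerProductSpace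
open Literature.MathematicalPhysics.QuantumFieldTheory
open Literature.MathematicalPhysics.QuantumLattice

namespace Summit.QuantumFields.YangMills.Theorems.FemtoTransferGap.TwoLattice.ConstTube

open Summit.QuantumFields.YangMills.Theorems.FemtoTransferGap
open Summit.QuantumFields.YangMills.Theorems.FemtoTransferGap.TwoLattice
open Summit.QuantumFields.YangMills.Theorems.FemtoTransferGap.TwoLattice.Avg
open Summit.QuantumFields.YangMills.Theorems.FemtoTransferGap.TwoLattice.Stiff
open Summit.QuantumFields.YangMills.Theorems.FemtoTransferGap.TwoLattice.Toron
open Summit.QuantumFields.YangMills.Theorems.FemtoTransferGap.TwoLattice.Cov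
open Summit.QuantumFields.YangMills.Theorems.TwistedTraceScaling.Negative.R45 (norm_su2Quat_inv_sub_one)

variable {L : ℕ} [NeZero L]

/-! ## §1 The size of the covariant relative links -/

omit [NeZero L] in
/-- `‖Ad(A)v‖∞ ≤ 2‖v‖∞` (a rotation; `√3 ≤ 2`). [folklore] -/
theorem norm_adRot_mulVec_le_two (A : SU2) (v : Fin 3 → ℝ) : ‖(adRot A).mulVec v‖ ≤ 2 * ‖v‖ := by
  have hsum := sum_sq_adRot_mulVec A v
  have h3 : ∑ a, v a ^ 2 ≤ 3 * ‖v‖ ^ 2 := by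
    calc ∑ a, v a ^ 2 ≤ ∑ _a : Fin 3, ‖v‖ ^ 2 := Finset.sum_le_sum fun a _ => by
            rw [← sq_abs]; exact pow_le_pow_left₀ (abs_nonneg _) (by rw [← Real.norm_eq_abs]; exact norm_le_pi_norm v a) 2
      _ = 3 * ‖v‖ ^ 2 := by simp
  refine (pi_norm_le_iff_of_nonneg (by positivity)).mpr fun a => ?_
  rw [Real.norm_eq_abs]
  have ha : ((adRot A).mulVec v a) ^ 2 ≤ ∑ b, ((adRot A).mulVec v b) ^ 2 := Finset.single_le_sum (f := fun b => ((adRot A).mulVec v b) ^ 2) (fun b _ => sq_nonneg _) (Finset.mem_univ a)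
  have h : ((adRot A).mulVec v a) ^ 2 ≤ (2 * ‖v‖) ^ 2 := by nlinarith [norm_nonneg v]
  exact abs_le_of_sq_le_sq' h (by positivity) |> fun h' => abs_le.mpr ⟨by linarith [h'.1], h'.2⟩

omit [NeZero L] in
/-- **Size of the covariant relative link**: `‖q(covRel u ζ x e) − 1‖ ≤ 6G + 2ω` for `‖ζ_y‖∞ ≤ G ≤ 1/12`, `‖x_e‖∞ ≤ ω ≤ 1/3`. [folklore] -/
theorem norm_covRel_sub_one_le {u : GaugeConfig 3 1 SU2} {ζ : Site 3 L → Fin 3 → ℝ} {x : Edge 3 L → Fin 3 → ℝ} {G ω : ℝ} (hG : ∀ y, ‖ζ y‖ ≤ G) (hG1 : G ≤ 1 / 12)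
    (hω : ∀ e, ‖x e‖ ≤ ω) (hω1 : ω ≤ 1 / 3) (e : Edge 3 L) : ‖su2Quat (covRel L u ζ x e) - 1‖ ≤ 6 * G + 2 * ω := by
  unfold covRel
  have h1 : ‖su2Quat (chartSU2 (ζ e.1)) - 1‖ ≤ 2 * G := norm_su2Quat_chartSU2_sub_one_le (hG e.1) (by linarith)
  have h2 : ‖su2Quat (chartSU2 (x e)) - 1‖ ≤ 2 * ω := norm_su2Quat_chartSU2_sub_one_le (hω e) hω1
  have h3 : ‖su2Quat (chartSU2 ((adRot (u (0, e.2))).mulVec (ζ (e.1.shift e.2))))⁻¹ - 1‖ ≤ 2 * (2 * G) := by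
    rw [norm_su2Quat_inv_sub_one]
    exact norm_su2Quat_chartSU2_sub_one_le ((norm_adRot_mulVec_le_two _ _).trans (by linarith [hG (e.1.shift e.2)])) (by linarith)
  calc _ ≤ ‖su2Quat (chartSU2 (ζ e.1) * chartSU2 (x e)) - 1‖ + ‖su2Quat (chartSU2 ((adRot (u (0, e.2))).mulVec (ζ (e.1.shift e.2))))⁻¹ - 1‖ :=
        RateTube.norm_su2Quat_mul_sub_one_le _ _
    _ ≤ (‖su2Quat (chartSU2 (ζ e.1)) - 1‖ + ‖su2Quat (chartSU2 (x e)) - 1‖) + ‖su2Quat (chartSU2 ((adRot (u (0, e.2))).mulVec (ζ (e.1.shift e.2))))⁻¹ - 1‖ := by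
        gcongr; exact RateTube.norm_su2Quat_mul_sub_one_le _ _
    _ ≤ _ := by linarith

/-! ## §2 ★★ One round of the bootstrap -/

/-- ★★ **ONE ROUND.**  See the module docstring: from `‖ζ_y‖∞ ≤ G ≤ 1/40`, `‖ζ̄‖∞ ≤ G_m` to `‖ζ − ζ̄‖∞ ≤ 2C_P(2τ + Y)` and `‖x̂'‖² ≤ τ² + (‖x̂‖ + 4τ + 4Y)²`,
`Y = √6·d + √(6|E|)((40(4G² + 2Gω) + 12τ_uG_m) + 4(6G + 2ω)m)`. [folklore] -/
theorem stiffSep_round {u u' : GaugeConfig 3 1 SU2} {x x' : Edge 3 L → Fin 3 → ℝ} (hx : x ∈ capBalancedSet L) (hx' : x' ∈ capBalancedSet L)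
    {ζ : Site 3 L → Fin 3 → ℝ} {G Gm ω τu τ C m d : ℝ} (hG : ∀ y, ‖ζ y‖ ≤ G) (hG1 : G ≤ 1 / 40) (hGm : ‖siteMean L ζ‖ ≤ Gm)
    (hω : ∀ e, ‖x e‖ ≤ ω) (hω1 : ω ≤ 1 / 20) (hτ1 : τu ≤ 1) (hu : ∀ (k : Fin 3) (c : Fin 3), |vecPart (u (0, k)) c| ≤ τu)
    (hC : 0 < C) (hP : ∀ ξ : Site 3 L → Fin 3 → ℝ, ∑ y : Site 3 L, ξ y = 0 → ‖ξ‖ ≤ C * ‖vacGrad L ξ‖) (hsmall : 12 * Real.sqrt (3 * Fintype.card (Edge 3 L)) * τu * C ≤ 1 / 2)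
    (hm : ∀ k : Fin 3, ‖su2Quat (u (0, k) * (u' (0, k))⁻¹) - 1‖ ≤ m)
    (hτx' : ‖(gaugeModes L).starProjection (linkEmbed L x')‖ ≤ τ) (hτx : ‖(gaugeModes L).starProjection (linkEmbed L x)‖ ≤ τ)
    (hd : 0 ≤ d) (hK : kinDefect L (orthoTube L u' x') (orthoTube L u x) (fun y => chartSU2 (ζ y)) ≤ d ^ 2) :
    ‖(fun y => ζ y - siteMean L ζ)‖ ≤ 2 * C * (2 * τ + (Real.sqrt 6 * d + Real.sqrt (6 * Fintype.card (Edge 3 L)) *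
        ((40 * (4 * G ^ 2 + 2 * G * ω) + 12 * τu * Gm) + 4 * (6 * G + 2 * ω) * m))) ∧
      ‖linkEmbed L x'‖ ^ 2 ≤ τ ^ 2 + (‖linkEmbed L x‖ + 4 * τ + 4 * (Real.sqrt 6 * d + Real.sqrt (6 * Fintype.card (Edge 3 L)) *
        ((40 * (4 * G ^ 2 + 2 * G * ω) + 12 * τu * Gm) + 4 * (6 * G + 2 * ω) * m))) ^ 2 := by
  have hB : ∀ e, ‖su2Quat (covRel L u ζ x e) - 1‖ ≤ 6 * G + 2 * ω := fun e => norm_covRel_sub_one_le hG (by linarith) hω (by linarith) e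
  have hx'1 : ∀ e, ∑ a, x' e a ^ 2 ≤ 1 := fun e => (hx'.2 e).trans (by norm_num)
  -- the link-space identity
  have hY := stiffSep_linkSpace_bound (L := L) hG hω hG1 hω1 hτ1 hu hGm hx'1 hB hm hd hK
  set Y : LinkSpace L := linkEmbed L x' - linkEmbed L x + covGradL L u (fun y => ζ y - siteMean L ζ) -
    (WithLp.toLp 2 fun ea : Edge 3 L × Fin 3 => (fun (c : Fin 3) (k : Fin 3) => vecPart (u (0, k) * (u' (0, k))⁻¹) c) ea.2 ea.1.2) with hYdef
  have hid : linkEmbed L x' = linkEmbed L x - covGradL L u (fun y => ζ y - siteMean L ζ) +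
      (WithLp.toLp 2 fun ea : Edge 3 L × Fin 3 => (fun (c : Fin 3) (k : Fin 3) => vecPart (u (0, k) * (u' (0, k))⁻¹) c) ea.2 ea.1.2) + Y := by
    rw [hYdef]; abel
  have hκ := constLink_mem_constModes (L := L) (fun (c : Fin 3) (k : Fin 3) => vecPart (u (0, k) * (u' (0, k))⁻¹) c)
  have hXb : ∀ c ∈ constModes L, ⟪c, linkEmbed L x⟫ = 0 := fun c hc => inner_constMode_linkEmbed_eq_zero hc hx.1
  have hX'b : ∀ c ∈ constModes L, ⟪c, linkEmbed L x'⟫ = 0 := fun c hc => inner_constMode_linkEmbed_eq_zero hc hx'.1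
  have hζ₀ : ∑ y : Site 3 L, (fun y => ζ y - siteMean L ζ) y = 0 := sum_sub_siteMean L ζ
  obtain ⟨h1, h2⟩ := stiffSep_radius_bound (L := L) hC hP hτ1 hsmall hu hζ₀ hid hκ hXb hX'b hτx' hτx
  have hτ0 : 0 ≤ τ := (norm_nonneg _).trans hτx
  have hx0 : 0 ≤ ‖linkEmbed L x‖ := norm_nonneg _
  refine ⟨h1.trans (by gcongr), h2.trans ?_⟩
  have hY0 : 0 ≤ ‖Y‖ := norm_nonneg _
  gcongr

/-! ## §3 ★★★ Two rounds for a based parameter -/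

/-- For a BASED parameter (`ζ 0 = 0`): `‖ζ̄‖ ≤ ‖ζ − ζ̄‖∞` and `‖ζ_y‖ ≤ 2‖ζ − ζ̄‖∞`. [folklore] -/
theorem norm_le_of_based {ζ : Site 3 L → Fin 3 → ℝ} (hζ0 : ζ 0 = 0) :
    ‖siteMean L ζ‖ ≤ ‖(fun y => ζ y - siteMean L ζ)‖ ∧ ∀ y, ‖ζ y‖ ≤ 2 * ‖(fun y => ζ y - siteMean L ζ)‖ := by
  have h0 : ‖siteMean L ζ‖ ≤ ‖(fun y => ζ y - siteMean L ζ)‖ := by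
    have h := norm_le_pi_norm (fun y => ζ y - siteMean L ζ) 0
    rw [hζ0, zero_sub, norm_neg] at h; exact h
  refine ⟨h0, fun y => ?_⟩
  have h := norm_le_pi_norm (fun y => ζ y - siteMean L ζ) y
  have e : ζ y = (ζ y - siteMean L ζ) + siteMean L ζ := by abel
  calc ‖ζ y‖ = ‖(ζ y - siteMean L ζ) + siteMean L ζ‖ := by rw [← e]
    _ ≤ ‖ζ y - siteMean L ζ‖ + ‖siteMean L ζ‖ := norm_add_le _ _
    _ ≤ _ := by linarith

/-- ★★★ **STIFF SEPARATION FOR A BASED NEAR-IDENTITY GAUGE FIELD (two rounds)**: with `ϑ` the a-priori size (`‖ζ_y‖∞ ≤ ϑ ≤ 1/40`, `ζ 0 = 0`),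
`g₁ := 2C_P(2τ + Y(ϑ,ϑ))` and `2g₁ ≤ 1/40`:  `‖x̂'‖² ≤ τ² + (‖x̂‖ + 4τ + 4·Y(2g₁, g₁))²`, `Y(G,G_m) = √6·d + √(6|E|)((40(4G² + 2Gω) + 12τ_uG_m) + 4(6G + 2ω)m)`.
[cite: Luscher1983, §3] -/
theorem stiffSep_based {u u' : GaugeConfig 3 1 SU2} {x x' : Edge 3 L → Fin 3 → ℝ} (hx : x ∈ capBalancedSet L) (hx' : x' ∈ capBalancedSet L)
    {ζ : Site 3 L → Fin 3 → ℝ} (hζ0 : ζ 0 = 0) {ϑ ω τu τ C m d : ℝ} (hϑ : ∀ y, ‖ζ y‖ ≤ ϑ) (hϑ1 : ϑ ≤ 1 / 40)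
    (hω : ∀ e, ‖x e‖ ≤ ω) (hω1 : ω ≤ 1 / 20) (hτ1 : τu ≤ 1) (hu : ∀ (k : Fin 3) (c : Fin 3), |vecPart (u (0, k)) c| ≤ τu)
    (hC : 0 < C) (hP : ∀ ξ : Site 3 L → Fin 3 → ℝ, ∑ y : Site 3 L, ξ y = 0 → ‖ξ‖ ≤ C * ‖vacGrad L ξ‖) (hsmall : 12 * Real.sqrt (3 * Fintype.card (Edge 3 L)) * τu * C ≤ 1 / 2)
    (hm : ∀ k : Fin 3, ‖su2Quat (u (0, k) * (u' (0, k))⁻¹) - 1‖ ≤ m)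
    (hτx' : ‖(gaugeModes L).starProjection (linkEmbed L x')‖ ≤ τ) (hτx : ‖(gaugeModes L).starProjection (linkEmbed L x)‖ ≤ τ)
    (hd : 0 ≤ d) (hK : kinDefect L (orthoTube L u' x') (orthoTube L u x) (fun y => chartSU2 (ζ y)) ≤ d ^ 2)
    (hg₁ : 2 * (2 * C * (2 * τ + (Real.sqrt 6 * d + Real.sqrt (6 * Fintype.card (Edge 3 L)) * ((40 * (4 * ϑ ^ 2 + 2 * ϑ * ω) + 12 * τu * ϑ) + 4 * (6 * ϑ + 2 * ω) * m)))) ≤ 1 / 40) :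
    ‖linkEmbed L x'‖ ^ 2 ≤ τ ^ 2 + (‖linkEmbed L x‖ + 4 * τ + 4 * (Real.sqrt 6 * d + Real.sqrt (6 * Fintype.card (Edge 3 L)) *
      ((40 * (4 * (2 * (2 * C * (2 * τ + (Real.sqrt 6 * d + Real.sqrt (6 * Fintype.card (Edge 3 L)) * ((40 * (4 * ϑ ^ 2 + 2 * ϑ * ω) + 12 * τu * ϑ) + 4 * (6 * ϑ + 2 * ω) * m))))) ^ 2 +
          2 * (2 * (2 * C * (2 * τ + (Real.sqrt 6 * d + Real.sqrt (6 * Fintype.card (Edge 3 L)) * ((40 * (4 * ϑ ^ 2 + 2 * ϑ * ω) + 12 * τu * ϑ) + 4 * (6 * ϑ + 2 * ω) * m))))) * ω) +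
        12 * τu * (2 * C * (2 * τ + (Real.sqrt 6 * d + Real.sqrt (6 * Fintype.card (Edge 3 L)) * ((40 * (4 * ϑ ^ 2 + 2 * ϑ * ω) + 12 * τu * ϑ) + 4 * (6 * ϑ + 2 * ω) * m))))) +
        4 * (6 * (2 * (2 * C * (2 * τ + (Real.sqrt 6 * d + Real.sqrt (6 * Fintype.card (Edge 3 L)) * ((40 * (4 * ϑ ^ 2 + 2 * ϑ * ω) + 12 * τu * ϑ) + 4 * (6 * ϑ + 2 * ω) * m))))) + 2 * ω) * m))) ^ 2 := by
  -- round 1 with `(G, G_m) = (ϑ, ϑ)`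
  have hGm0 : ‖siteMean L ζ‖ ≤ ϑ := norm_siteMean_le L hϑ
  obtain ⟨h1, -⟩ := stiffSep_round (L := L) hx hx' hϑ hϑ1 hGm0 hω hω1 hτ1 hu hC hP hsmall hm hτx' hτx hd hK
  -- round 2 with `(G, G_m) = (2g₁, g₁)`
  obtain ⟨hb1, hb2⟩ := norm_le_of_based (L := L) hζ0
  set g₁ : ℝ := 2 * C * (2 * τ + (Real.sqrt 6 * d + Real.sqrt (6 * Fintype.card (Edge 3 L)) * ((40 * (4 * ϑ ^ 2 + 2 * ϑ * ω) + 12 * τu * ϑ) + 4 * (6 * ϑ + 2 * ω) * m)))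
    with hg₁def
  have hG : ∀ y, ‖ζ y‖ ≤ 2 * g₁ := fun y => (hb2 y).trans (by linarith)
  have hGm : ‖siteMean L ζ‖ ≤ g₁ := hb1.trans h1
  obtain ⟨-, h2⟩ := stiffSep_round (L := L) hx hx' hG hg₁ hGm hω hω1 hτ1 hu hC hP hsmall hm hτx' hτx hd hK
  exact h2

end Summit.QuantumFields.YangMills.Theorems.FemtoTransferGap.TwoLattice.ConstTube

end
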